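import Summits.KontsevichZagierPeriods.Zeta5Search.WedgeDictionaryRec3
import Summits.KontsevichZagierPeriods.Zeta5Search.WedgeDictionaryFace
import HarnessLib

/-!
# CF-M3 one step into the interior: all shapes with `min_j b_j ≤ 1` (cell `pub-zeta5`)

HONEST FRAMING: systematic search; no irrationality claim unless certified.

OUR work (Summit side; lead/literature seat generation 4, 2026-08-20). First layer of step L9 of the cell's Lean
plan for the interior of CF-M3 (`casoratianClosedForm`; PROOF-NOTES-g5 §4, §10.2): the slot-7 bookkeeping of the
closed form and the initial identity I1, giving CF-M3 for every admissible `b` with `b₇ = 1`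
(`casoratianClosedForm_bseven_one`) and hence, by slot symmetry, for every admissible `b` with SOME `b_j ≤ 1`
(`casoratianClosedForm_of_slot_le_one`) — in particular for the whole first interior layer `min_j b_j = 1`
(e.g. `(N;1⁷)`), where `Ω(b)` is no longer `1`.

* `omegaVWP_bseven_one`: for `b₇ = 1` (and `b_i + 1 ≤ N`, `N ≥ 2`):
  `Ω(b)·∏_{i≤6}(N−b_i) = ∏_{i≤6}(N−b_i) − ∏_{i≤6} b_i` (only the terms `m = 0, 1` of the very-well-poised sum survive).
* `en_qZero`: `N·q₀ = ∏_{i≤6}(N−b_i) − ∏_{i≤6} b_i` for the constant coefficient `q₀` of `face_threeTerm_seven`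
  (identity I1 of the notes).
* slot-7 bookkeeping `pairProd_slot7_step`, `singles_slot7_step`, `dfact_slot7_step`:
  `∏_{j<k}(N−a_j−a_k)! = ∏_{j<k}(N−a'_j−a'_k)!·∏_{i≤6}(N−a_i−a₇)`, `∏_k(N−a_k)! = ∏_k(N−a'_k)!·(N−a₇)`,
  `d(a)! = d(a')!·d(a)` for `a' = a + e₇`.
* `casoratianClosedForm_bseven_one`: from `casoratianClosedForm_face` at `a = b − e₇`, `face_initial`
  (`d(a)·M₃(b) = q₀·M₃(a)`) and the three bookkeeping identities.
* `omegaVWP_swap` (`Ω` is symmetric in the slots) and `casoratianClosedForm_of_slot_le_one` (transport).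
-/

noncomputable section

open Finset Polynomial

namespace Summit.KontsevichZagierPeriods.Zeta5Search.WedgeDictionary

open Summit.KontsevichZagierPeriods.Zeta5Search.DualSeries
open Literature.NumberTheory.Transcendental

/-! ### `Ω` one step into the interior -/

/-- For `b₇ = 1`: `Ω(b)·∏_{i≤6}(N − b_i) = ∏_{i≤6}(N − b_i) − ∏_{i≤6} b_i` (`N ≥ 2`, all `b_i < N`). -/
theorem omegaVWP_bseven_one (b : ℕ → ℤ) (h7 : b 7 = 1) (hN : 2 ≤ b 0)
    (hc : ∀ i ∈ range 6, b (i + 1) + 1 ≤ b 0) :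
    omegaVWP b * ∏ i ∈ range 6, ((b 0 : ℚ) - b (i + 1)) =
      (∏ i ∈ range 6, ((b 0 : ℚ) - b (i + 1))) - ∏ i ∈ range 6, (b (i + 1) : ℚ) := by
  have h67 : b (6 + 1) = 1 := h7
  have hNn : (b 0).toNat + 1 = ((b 0).toNat - 1) + 1 + 1 := by omega
  have hne : ∀ i ∈ range 6, ((b (i + 1) : ℚ) - b 0) ≠ 0 := by
    intro i hi
    have := hc i hi
    have : ((b (i + 1) : ℤ) : ℚ) + 1 ≤ ((b 0 : ℤ) : ℚ) := by exact_mod_cast this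
    intro h; linarith
  have hN1 : ((1 : ℚ) - b 0) ≠ 0 := by
    have : (2 : ℚ) ≤ ((b 0 : ℤ) : ℚ) := by exact_mod_cast hN
    intro h; linarith
  have hN2 : ((b 0 : ℚ) + 1) ≠ 0 := by
    have : (2 : ℚ) ≤ ((b 0 : ℤ) : ℚ) := by exact_mod_cast hN
    intro h; linarith
  unfold omegaVWP
  rw [hNn, sum_range_succ', sum_range_succ']
  -- the terms `m ≥ 2` vanish: the slot-7 numerator `(−1)_m = 0`
  rw [sum_eq_zero (fun m _ => by
    apply mul_eq_zero_of_right
    apply prod_eq_zero (mem_range.2 (by norm_num : 6 < 7))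
    rw [h67, ascPochhammer_succ_left, eval_mul, eval_comp, eval_add, eval_X, eval_one]
    push_cast
    rw [show (-1 : ℚ) + 1 = 0 by ring, ascPochhammer_eval_zero]
    simp), zero_add]
  -- the terms `m = 1` and `m = 0`
  simp only [Nat.reduceAdd]
  simp only [prod_range_succ, prod_range_zero, one_mul, ascPochhammer_zero, ascPochhammer_one, eval_one, eval_X,
    Nat.factorial_zero, Nat.factorial_one, Nat.cast_one, Nat.cast_zero, div_one, mul_zero, zero_div, sub_zero, h7]
  have h1 : ((b 1 : ℚ) - b 0) ≠ 0 := hne 0 (by simp)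
  have h2 : ((b 2 : ℚ) - b 0) ≠ 0 := hne 1 (by simp)
  have h3 : ((b 3 : ℚ) - b 0) ≠ 0 := hne 2 (by simp)
  have h4 : ((b 4 : ℚ) - b 0) ≠ 0 := hne 3 (by simp)
  have h5 : ((b 5 : ℚ) - b 0) ≠ 0 := hne 4 (by simp)
  have h6 : ((b 6 : ℚ) - b 0) ≠ 0 := hne 5 (by simp)
  push_cast
  field_simp
  ring

/-- The constant coefficient `q₀ = N⁵ − e₁N⁴ + e₂N³ − e₃N² + e₄N − e₅` of `face_threeTerm_seven` satisfies
`N·q₀ = ∏_{i≤6}(N − b_i) − ∏_{i≤6} b_i` (identity I1 of PROOF-NOTES-g5 §4.3). -/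
theorem en_qZero (b : ℕ → ℤ) :
    (b 0 : ℚ) * ((b 0 : ℚ) ^ 5 - fe1 b * (b 0 : ℚ) ^ 4 + fe2 b * (b 0 : ℚ) ^ 3 - fe3 b * (b 0 : ℚ) ^ 2 +
        fe4 b * (b 0 : ℚ) - fe5 b) =
      (∏ i ∈ range 6, ((b 0 : ℚ) - b (i + 1))) - ∏ i ∈ range 6, (b (i + 1) : ℚ) := by
  simp only [fe1, fe2, fe3, fe4, fe5, prod_range_succ, prod_range_zero]
  ring

/-! ### Slot-7 bookkeeping of the closed form -/

/-- `∏_{j<k}(N − a_j − a_k)! = ∏_{j<k}(N − a'_j − a'_k)! · ∏_{i≤6}(N − a_i − a₇)` for `a' = a + e₇`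
(pairs `(i,7)` lose one unit), provided `a_i + a₇ + 1 ≤ N`. -/
theorem pairProd_slot7_step (a : ℕ → ℤ) (hp : ∀ i ∈ range 6, a (i + 1) + a 7 + 1 ≤ a 0) :
    (allPairs.map fun jk => ((a 0 - a jk.1 - a jk.2).toNat.factorial : ℚ)).prod =
      (allPairs.map fun jk => ((a 0 - bump a 6 jk.1 - bump a 6 jk.2).toNat.factorial : ℚ)).prod *
        ∏ i ∈ range 6, ((a 0 : ℚ) - a (i + 1) - a 7) := by
  have hR : (allPairs.map fun jk : ℕ × ℕ => if jk.2 = 7 then ((a 0 : ℚ) - a jk.1 - a 7) else 1).prod =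
      ∏ i ∈ range 6, ((a 0 : ℚ) - a (i + 1) - a 7) := by
    simp only [allPairs, List.map_cons, List.map_nil, List.prod_cons, List.prod_nil, Nat.reduceEqDiff, reduceIte,
      prod_range_succ, prod_range_zero, one_mul, mul_one, Nat.reduceAdd]
    ring
  rw [← hR, ← List.prod_map_mul]
  congr 1
  refine List.map_congr_left fun jk hjk => ?_
  obtain ⟨h1, h12, h2⟩ := allPairs_bounds jk hjk
  have e1 : bump a 6 jk.1 = a jk.1 := bump_of_ne a (by omega)
  by_cases hk : jk.2 = 7
  · rw [if_pos hk, e1, hk, show bump a 6 7 = a 7 + 1 from bump_self a 6]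
    have hj6 : jk.1 - 1 ∈ range 6 := mem_range.2 (by omega)
    have hnn : 0 ≤ a 0 - a jk.1 - (a 7 + 1) := by
      have := hp (jk.1 - 1) hj6; rw [Nat.sub_add_cancel h1] at this; omega
    rw [show a 0 - a jk.1 - a 7 = (a 0 - a jk.1 - (a 7 + 1)) + 1 by ring, toNat_factorial_succ _ hnn]
    push_cast; ring
  · rw [if_neg hk, e1, bump_of_ne a (show jk.2 ≠ 6 + 1 by omega), mul_one]

/-- `∏_k (N − a_k)! = ∏_k (N − a'_k)! · (N − a₇)` for `a' = a + e₇` (`a₇ + 1 ≤ N`). -/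
theorem singles_slot7_step (a : ℕ → ℤ) (h : a 7 + 1 ≤ a 0) :
    ∏ j ∈ range 7, ((a 0 - a (j + 1)).toNat.factorial : ℚ) =
      (∏ j ∈ range 7, ((a 0 - bump a 6 (j + 1)).toNat.factorial : ℚ)) * ((a 0 : ℚ) - a 7) := by
  conv_lhs => rw [prod_range_succ]
  conv_rhs => rw [prod_range_succ]
  have hsame : ∏ j ∈ range 6, ((a 0 - bump a 6 (j + 1)).toNat.factorial : ℚ) =
      ∏ j ∈ range 6, ((a 0 - a (j + 1)).toNat.factorial : ℚ) :=
    prod_congr rfl fun j hj => by rw [bump_of_ne a (by have := mem_range.1 hj; omega)]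
  rw [hsame, show bump a 6 (6 + 1) = a 7 + 1 from bump_self a 6, show a (6 + 1) = a 7 from rfl,
    show a 0 - a 7 = (a 0 - (a 7 + 1)) + 1 by ring, toNat_factorial_succ _ (by omega)]
  push_cast; ring

/-- `d(a)! = d(a')!·d(a)` for `a' = a + e₇` (`d(a) ≥ 1`). -/
theorem dfact_slot7_step (a : ℕ → ℤ) (hd : 1 ≤ dOf a) :
    (((dOf a).toNat.factorial : ℕ) : ℚ) = (((dOf (bump a 6)).toNat.factorial : ℕ) : ℚ) * (dOf a : ℚ) := by
  rw [dOf_bump a (mem_range.2 (by norm_num)), show dOf a = (dOf a - 1) + 1 by ring, toNat_factorial_succ _ (by omega)]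
  push_cast; ring

/-! ### CF-M3 for `b₇ = 1` -/

/-- **CF-M3 for every admissible `b` with `b₇ = 1`** (the first interior layer along slot 7: face theorem at
`a = b − e₇`, the initial identity `d(a)·M₃(b) = q₀·M₃(a)` of `face_initial`, I1 in the form `en_qZero`, and the
slot-7 bookkeeping). -/
theorem casoratianClosedForm_bseven_one (b : ℕ → ℤ) (hb : InBox b) (hd : 0 ≤ dOf b)
    (hle : ∀ j ∈ Icc 1 7, b j ≤ b 0) (hpairs : ∀ jk ∈ allPairs, b jk.1 + b jk.2 ≤ b 0) (h7 : b 7 = 1) :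
    quadM3 b * (((b 0).toNat.factorial : ℚ) *
        (allPairs.map fun jk => ((b 0 - b jk.1 - b jk.2).toNat.factorial : ℚ)).prod) =
      (-1 : ℚ) ^ (b 0).toNat * 4 * ((dOf b).toNat.factorial : ℚ) *
        (∏ j ∈ range 7, ((b 0 - b (j + 1)).toNat.factorial : ℚ)) * omegaVWP b := by
  -- if some slot vanishes we are on a face
  by_cases hz : ∃ j ∈ Icc 1 7, b j = 0
  · obtain ⟨j, hj, hj0⟩ := hz
    exact casoratianClosedForm_of_slot_zero b hb hd hle hpairs hj hj0
  push Not at hz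
  have hi7 : (6 : ℕ) ∈ range 7 := mem_range.2 (by norm_num)
  have hpos : ∀ i ∈ range 6, 1 ≤ b (i + 1) := fun i hi => by
    have h0 := (hb.2 i (by have := mem_range.1 hi; exact mem_range.2 (by omega))).1
    have h1 := hz (i + 1) (mem_Icc.2 ⟨by omega, by have := mem_range.1 hi; omega⟩)
    omega
  have hc : ∀ i ∈ range 6, b (i + 1) + 1 ≤ b 0 := fun i hi => by
    have := pair_le_of_allPairs hpairs (j := i + 1) (k := 7) (by omega) (by have := mem_range.1 hi; omega)
      (by norm_num) le_rfl (by have := mem_range.1 hi; omega)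
    omega
  have hN2 : 2 ≤ b 0 := by have := hc 0 (by simp); have := hpos 0 (by simp); omega
  -- the face point `a = b − e₇`
  set a : ℕ → ℤ := Function.update b 7 0 with ha
  have ha7 : a 7 = 0 := Function.update_self _ _ _
  have ha_ne : ∀ k, k ≠ 7 → a k = b k := fun k hk => Function.update_of_ne hk _ _
  have ha0 : a 0 = b 0 := ha_ne 0 (by norm_num)
  have hbump : bump a 6 = b := by
    unfold bump
    rw [show (6 : ℕ) + 1 = 7 from rfl, ha7, zero_add, ha, Function.update_idem, ← h7, Function.update_eq_self]
  have hmono : ∀ k, a k ≤ b k := fun k => by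
    by_cases hk : k = 7
    · rw [hk, ha7, h7]; norm_num
    · rw [ha_ne k hk]
  have ha_box : InBox a := by
    refine ⟨by rw [ha0]; exact hb.1, fun j hj => ?_⟩
    by_cases hj6 : j = 6
    · rw [hj6, show (6 : ℕ) + 1 = 7 from rfl, ha7, ha0]; constructor <;> omega
    · rw [ha_ne (j + 1) (by omega), ha0]; exact hb.2 j hj
  have hda : dOf a = dOf b + 1 := by
    have := dOf_bump a hi7; rw [hbump] at this; omega
  have hle_a : ∀ j ∈ Icc 1 7, a j ≤ a 0 := fun j hj => by rw [ha0]; exact (hmono j).trans (hle j hj)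
  have hpairs_a : ∀ jk ∈ allPairs, a jk.1 + a jk.2 ≤ a 0 := fun jk hjk => by
    rw [ha0]; have := hpairs jk hjk; have := hmono jk.1; have := hmono jk.2; omega
  -- the face theorem at `a` and the initial identity
  have CFa := casoratianClosedForm_face a ha_box (by omega) hle_a hpairs_a ha7
  rw [omegaVWP_eq_one (j := 6) hi7 ha7, mul_one, ha0, hda] at CFa
  have init := (face_initial a ha_box ha7 (by omega)).1
  rw [hbump, hda, ha0] at init
  push_cast at init
  -- I1 and Ω(b)
  have hprodN : ∏ i ∈ range 6, ((a 0 : ℚ) - a (i + 1)) = ∏ i ∈ range 6, ((b 0 : ℚ) - b (i + 1)) :=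
    prod_congr rfl fun i hi => by rw [ha0, ha_ne (i + 1) (by have := mem_range.1 hi; omega)]
  have hprodC : ∏ i ∈ range 6, (a (i + 1) : ℚ) = ∏ i ∈ range 6, (b (i + 1) : ℚ) :=
    prod_congr rfl fun i hi => by rw [ha_ne (i + 1) (by have := mem_range.1 hi; omega)]
  have hprodP : ∏ i ∈ range 6, ((a 0 : ℚ) - a (i + 1) - a 7) = ∏ i ∈ range 6, ((b 0 : ℚ) - b (i + 1)) :=
    prod_congr rfl fun i hi => by
      rw [ha0, ha_ne (i + 1) (by have := mem_range.1 hi; omega), ha7]; push_cast; ring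
  have hq0 := en_qZero a
  rw [hprodN, hprodC, ha0] at hq0
  have hΩ := omegaVWP_bseven_one b h7 hN2 hc
  -- slot-7 bookkeeping at `a`
  have hP := pairProd_slot7_step a (fun i hi => by
    rw [ha_ne (i + 1) (by have := mem_range.1 hi; omega), ha7, ha0]; have := hc i hi; omega)
  rw [hprodP, hbump, ha0] at hP
  have hF := singles_slot7_step a (by rw [ha7, ha0]; omega)
  rw [hbump, ha7, ha0] at hF
  push_cast at hF
  have hD := dfact_slot7_step a (by omega)
  rw [hbump, hda] at hD
  push_cast at hD
  -- nonvanishing of the multiplier `d(a)·∏(N − b_i)`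
  have hPN : 0 < ∏ i ∈ range 6, ((b 0 : ℚ) - b (i + 1)) := prod_pos fun i hi => by
    have := hc i hi
    have : ((b (i + 1) : ℤ) : ℚ) + 1 ≤ ((b 0 : ℤ) : ℚ) := by exact_mod_cast this
    linarith
  have hd1 : (0 : ℚ) < (dOf b : ℚ) + 1 := by
    have : (0 : ℚ) ≤ ((dOf b : ℤ) : ℚ) := by exact_mod_cast hd
    linarith
  have hK : ((dOf b : ℚ) + 1) * ∏ i ∈ range 6, ((b 0 : ℚ) - b (i + 1)) ≠ 0 := by positivity
  refine mul_left_cancel₀ hK ?_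
  set PN := ∏ i ∈ range 6, ((b 0 : ℚ) - b (i + 1)) with hPNdef
  set PC := ∏ i ∈ range 6, (b (i + 1) : ℚ) with hPCdef
  set Pa := (allPairs.map fun jk => ((b 0 - a jk.1 - a jk.2).toNat.factorial : ℚ)).prod with hPadef
  set Pb := (allPairs.map fun jk => ((b 0 - b jk.1 - b jk.2).toNat.factorial : ℚ)).prod with hPbdef
  set Fa := ∏ j ∈ range 7, ((b 0 - a (j + 1)).toNat.factorial : ℚ) with hFadef
  set Fb := ∏ j ∈ range 7, ((b 0 - b (j + 1)).toNat.factorial : ℚ) with hFbdef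
  set NF := ((b 0).toNat.factorial : ℚ) with hNFdef
  set q0 := (b 0 : ℚ) ^ 5 - fe1 a * (b 0 : ℚ) ^ 4 + fe2 a * (b 0 : ℚ) ^ 3 - fe3 a * (b 0 : ℚ) ^ 2 +
    fe4 a * (b 0 : ℚ) - fe5 a with hq0def
  linear_combination (PN * NF * Pb) * init - (q0 * quadM3 a * NF) * hP + q0 * CFa +
    (q0 * ((-1 : ℚ) ^ (b 0).toNat * 4) * Fa) * hD +
    (q0 * ((-1 : ℚ) ^ (b 0).toNat * 4) * (((dOf b).toNat.factorial : ℕ) : ℚ) * ((dOf b : ℚ) + 1)) * hF +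
    (((-1 : ℚ) ^ (b 0).toNat * 4) * (((dOf b).toNat.factorial : ℕ) : ℚ) * ((dOf b : ℚ) + 1) * Fb) * hq0 -
    (((dOf b : ℚ) + 1) * ((-1 : ℚ) ^ (b 0).toNat * 4) * (((dOf b).toNat.factorial : ℕ) : ℚ) * Fb) * hΩ

/-! ### Every admissible shape with some slot `≤ 1` -/

/-- `Ω` is symmetric in the slots `b₁,…,b₇`. -/
theorem omegaVWP_swap (b : ℕ → ℤ) {j k : ℕ} (hj : j ∈ Icc 1 7) (hk : k ∈ Icc 1 7) :
    omegaVWP (fun i => b (Equiv.swap j k i)) = omegaVWP b := by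
  obtain ⟨hj1, hj7⟩ := mem_Icc.1 hj
  obtain ⟨hk1, hk7⟩ := mem_Icc.1 hk
  have h0 : Equiv.swap j k 0 = 0 := Equiv.swap_apply_of_ne_of_ne (by omega) (by omega)
  unfold omegaVWP
  dsimp only
  rw [h0]
  refine sum_congr rfl fun m _ => ?_
  congr 1
  refine Finset.prod_equiv (Equiv.swap (j - 1) (k - 1)) (fun i => ?_) (fun i _ => by rw [swap_succ hj1 hk1])
  simp only [mem_range]
  rw [Equiv.swap_apply_def]
  split_ifs <;> omega

/-- **CF-M3 for every admissible `b` with some `b_j ≤ 1`** (`j ∈ [1,7]`): faces by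
`casoratianClosedForm_of_slot_zero`, the layer `b_j = 1` by transport of `casoratianClosedForm_bseven_one`
along the slot transposition `(j 7)`. In particular CF-M3 holds on the whole first interior layer `min_j b_j = 1`. -/
theorem casoratianClosedForm_of_slot_le_one (b : ℕ → ℤ) (hb : InBox b) (hd : 0 ≤ dOf b)
    (hle : ∀ j ∈ Icc 1 7, b j ≤ b 0) (hpairs : ∀ jk ∈ allPairs, b jk.1 + b jk.2 ≤ b 0) {j : ℕ} (hj : j ∈ Icc 1 7)
    (hj1 : b j ≤ 1) :
    quadM3 b * (((b 0).toNat.factorial : ℚ) *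
        (allPairs.map fun jk => ((b 0 - b jk.1 - b jk.2).toNat.factorial : ℚ)).prod) =
      (-1 : ℚ) ^ (b 0).toNat * 4 * ((dOf b).toNat.factorial : ℚ) *
        (∏ j ∈ range 7, ((b 0 - b (j + 1)).toNat.factorial : ℚ)) * omegaVWP b := by
  obtain ⟨hj1', hj7⟩ := mem_Icc.1 hj
  have hj0 : 0 ≤ b j := by
    have := (hb.2 (j - 1) (mem_range.2 (by omega))).1
    rwa [Nat.sub_add_cancel hj1'] at this
  by_cases hz : b j = 0
  · exact casoratianClosedForm_of_slot_zero b hb hd hle hpairs hj hz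
  have hone : b j = 1 := by omega
  -- transport along the transposition (j 7)
  have h77 : (7 : ℕ) ∈ Icc 1 7 := mem_Icc.2 ⟨by norm_num, le_rfl⟩
  have e00 : Equiv.swap j 7 0 = 0 := Equiv.swap_apply_of_ne_of_ne (by omega) (by omega)
  have hrange : ∀ i, i ∈ Icc 1 7 → Equiv.swap j 7 i ∈ Icc 1 7 := by
    intro i hi
    obtain ⟨hi1, hi7⟩ := mem_Icc.1 hi
    rw [Equiv.swap_apply_def]
    split_ifs <;> simp only [mem_Icc] <;> omega
  set b' : ℕ → ℤ := fun i => b (Equiv.swap j 7 i) with hb'def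
  have eslot : ∀ i, b' i = b (Equiv.swap j 7 i) := fun i => rfl
  have e0 : b' 0 = b 0 := by rw [eslot, e00]
  have e7 : b' 7 = 1 := by rw [eslot, Equiv.swap_apply_right]; exact hone
  have hb' : InBox b' := by
    refine ⟨by rw [e0]; exact hb.1, fun i hi => ?_⟩
    have hi7 := mem_range.1 hi
    obtain ⟨hm1, hm7⟩ := mem_Icc.1 (hrange (i + 1) (mem_Icc.2 ⟨by omega, by omega⟩))
    have := hb.2 (Equiv.swap j 7 (i + 1) - 1) (mem_range.2 (by omega))
    rw [Nat.sub_add_cancel hm1] at this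
    rw [eslot, e0]; exact this
  have hsum' : ∑ i ∈ range 7, b' (i + 1) = ∑ i ∈ range 7, b (i + 1) := by
    simp only [eslot]
    refine Finset.sum_equiv (Equiv.swap (j - 1) (7 - 1)) (fun i => ?_) (fun i _ => by rw [swap_succ hj1' (by norm_num)])
    simp only [mem_range]
    rw [Equiv.swap_apply_def]
    split_ifs <;> omega
  have hd' : dOf b' = dOf b := by unfold dOf; rw [hsum', e0]
  have hle' : ∀ i ∈ Icc 1 7, b' i ≤ b' 0 := fun i hi => by rw [eslot, e0]; exact hle _ (hrange i hi)
  have hpairs' : ∀ jk ∈ allPairs, b' jk.1 + b' jk.2 ≤ b' 0 := by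
    intro jk hjk
    obtain ⟨h1, h12, h2⟩ := allPairs_bounds jk hjk
    obtain ⟨hm1, hm1'⟩ := mem_Icc.1 (hrange jk.1 (mem_Icc.2 ⟨h1, by omega⟩))
    obtain ⟨hm2, hm2'⟩ := mem_Icc.1 (hrange jk.2 (mem_Icc.2 ⟨by omega, h2⟩))
    have hne : Equiv.swap j 7 jk.1 ≠ Equiv.swap j 7 jk.2 := fun h => by
      have := (Equiv.swap j 7).injective h; omega
    rw [eslot, eslot, e0]
    exact pair_le_of_allPairs hpairs hm1 hm1' hm2 hm2' hne
  have key := casoratianClosedForm_bseven_one b' hb' (by rw [hd']; exact hd) hle' hpairs' e7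
  have hq : quadM3 b' = quadM3 b := quadM3_swap b hj h77
  have hP : (allPairs.map fun jk => ((b' 0 - b' jk.1 - b' jk.2).toNat.factorial : ℚ)).prod =
      (allPairs.map fun jk => ((b 0 - b jk.1 - b jk.2).toNat.factorial : ℚ)).prod := by
    simp only [eslot, e00]
    exact pairProd_swap7 b hj
  have hF : ∏ i ∈ range 7, ((b' 0 - b' (i + 1)).toNat.factorial : ℚ) =
      ∏ i ∈ range 7, ((b 0 - b (i + 1)).toNat.factorial : ℚ) := by
    simp only [eslot, e00]
    refine Finset.prod_equiv (Equiv.swap (j - 1) (7 - 1)) (fun i => ?_) (fun i _ => by rw [swap_succ hj1' (by norm_num)])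
    simp only [mem_range]
    rw [Equiv.swap_apply_def]
    split_ifs <;> omega
  have hΩ : omegaVWP b' = omegaVWP b := omegaVWP_swap b hj h77
  rw [hq, hP, hF, hΩ, hd', e0] at key
  exact key

end Summit.KontsevichZagierPeriods.Zeta5Search.WedgeDictionary
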